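import Mathlib
import Summits.NavierStokesRegularity.NavierStokesRegularity.Theorems.EulerZoomLiouvillePowerGaugeEulerLiouvilleSelfSimilarPastExtension
import Summits.NavierStokesRegularity.NavierStokesRegularity.Theorems.EulerZoomLiouvillePowerGaugeEulerLiouvilleSpiralProfileGradient
import Summits.NavierStokesRegularity.NavierStokesRegularity.Theorems.EulerZoomLiouvillePowerGaugeEulerLiouvillePressureSlavingIsometry
import HarnessLib

/-!
# Crux `EulerZoomLiouville.PowerGaugeEulerLiouville` (stmt-NavierStokesRegularity-19832), line `relative_equilibria` (ns-idea-11), R3a PORT RECIPE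
# brick P5: THE ORIGIN-CENTRED SPIRAL EXTENSION OF A PAST-EXACT SPIRAL MEMBER IS A DISTRIBUTIONAL EULER PAIR ON THE WHOLE SLAB

Route №10 `EulerZoomLiouville` (NavierStokesRegularity), crux E; width seat ns-ezl-w1 g10 under the LEAD ns-typeII-p2 (R3a recipe, brick P5 =
spiral twin of `Shifted.isDistributional_selfSimilarCollapse_of_past`, …SelfSimilarPastExtension).

KEY ALGEBRA (ii) of the recipe: the Euler `β`-rescaling `(s, y) ↦ (β^{1−γ} u(T + βs, x₀ + β^γ y), β^{2(1−γ)} p(…))` of a spiral member about `(T, x₀)`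
(`u(τ, x) = λ^{γ−1} e^{(log λ)S} V(e^{−(log λ)S} λ^{−γ}(x − x₀))`, `p(τ, x) = λ^{2γ−2} P(e^{−(log λ)S} λ^{−γ}(x − x₀))`, `λ = T − τ`, for `τ < T₁`) is, on the
slab `s < b` that the rescaling maps into the spiral era, the CONJUGATE BY THE FIXED ROTATION `R_β = e^{(log β)S}` of the origin-centred spiral pair
(`e^{(log(β(−s)))S} = R_β e^{(log(−s))S}`, group law `rss_exp_add_smul`); conjugation by a fixed linear isometry preserves distributional Euler pairs
(`PressureSlaving.isDistributional_conj_isometry`), and locality in time (`Shifted.isDistributional_slab_Iio_zero_of_forall`) finishes.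

* ★ `Spiral.isDistributional_spiralCollapse_of_pastSpiral` — `(u, p)` distributional Euler on `(−∞,0) × ℝ³`, spiral about `(T, x₀)` with generator `S`
  (skew), velocity profile `V` and scalar pressure profile `P` for `τ < T₁` (`T₁ ≤ 0`, `T₁ ≤ T`) ⇒ the ORIGIN-CENTRED spiral pair
  `ũ(s, y) = (−s)^{γ−1} e^{(log(−s))S} V(e^{−(log(−s))S} (−s)^{−γ} y)`, `p̃(s, y) = (−s)^{2(γ−1)} P(e^{−(log(−s))S} (−s)^{−γ} y)` is a distributional Euler
  pair on `(−∞,0) × ℝ³`.  `S = 0` is the untwisted brick.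

WHAT THIS IS NOT: not NS, not E, not a stub: one brick (P5) of the port R3a of a width sub-line; 19832 OPEN; no summit statement is proved by this file.
[folklore; ChaeTsai2013DSS p. 4 (Perelman's rotated ansatz)]
-/

noncomputable section

-- flat `Theorems/<Route><Decl>…` files of one crux share the namespace of the crux (tree convention: `Summit.<S>.<S>.…`)
set_option linter.dupNamespace false

open MeasureTheory Set Filter Topology Metric Function TopologicalSpace
open scoped ENNReal NNReal RealInnerProductSpace

namespace Summit.NavierStokesRegularity.NavierStokesRegularity.Theorems.PowerGaugeEulerLiouville

open Literature.Analysis Literature.Analysis.FunctionSpaces Literature.Analysis.FluidPDE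

namespace Spiral

variable {S : EuclideanSpace ℝ (Fin 3) →L[ℝ] EuclideanSpace ℝ (Fin 3)}

/-- **Group law read through the rotation `R_β`**: for `β, s > 0` and `R_β = e^{(log β)S}`,
`e^{(log(βs))S} v = R_β (e^{(log s)S} v)` and `e^{−(log(βs))S} w = e^{−(log s)S} (R_β⁻¹ w)`. [folklore] -/
theorem exp_log_mul_apply {β s : ℝ} (hβ : 0 < β) (hs : 0 < s)
    {R : EuclideanSpace ℝ (Fin 3) ≃ₗᵢ[ℝ] EuclideanSpace ℝ (Fin 3)}
    (hR : ∀ y, R y = NormedSpace.exp ((Real.log β) • S) y) (hRs : ∀ y, R.symm y = NormedSpace.exp ((-Real.log β) • S) y)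
    (v w : EuclideanSpace ℝ (Fin 3)) :
    NormedSpace.exp ((Real.log (β * s)) • S) v = R (NormedSpace.exp ((Real.log s) • S) v) ∧
      NormedSpace.exp ((-Real.log (β * s)) • S) w = NormedSpace.exp ((-Real.log s) • S) (R.symm w) := by
  rw [Real.log_mul hβ.ne' hs.ne']
  constructor
  · rw [rss_exp_add_smul S (Real.log β) (Real.log s), ContinuousLinearMap.mul_def, ContinuousLinearMap.comp_apply, hR]
  · rw [show -(Real.log β + Real.log s) = (-Real.log s) + (-Real.log β) by ring,
      rss_exp_add_smul S (-Real.log s) (-Real.log β), ContinuousLinearMap.mul_def, ContinuousLinearMap.comp_apply, hRs]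

/-- ★ **THE ORIGIN-CENTRED SPIRAL EXTENSION OF A PAST-EXACT SPIRAL MEMBER IS A DISTRIBUTIONAL EULER PAIR ON THE WHOLE SLAB.**  Let `(u, p)` be a
distributional Euler pair on `(−∞,0) × ℝ³` which, for `τ < T₁` (`T₁ ≤ 0`, `T₁ ≤ T`), is the spiral (rotated self-similar) pair about `(T, x₀)` with skew
generator `S`, exponent `γ` and profiles `(V, P)`:
`u(τ, x) = λ^{γ−1} e^{(log λ)S} V(e^{−(log λ)S} λ^{−γ}(x − x₀))`, `p(τ, x) = λ^{2(γ−1)} P(e^{−(log λ)S} λ^{−γ}(x − x₀))`, `λ = T − τ`.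
Then the origin-centred spiral pair `ũ(s, y) = (−s)^{γ−1} e^{(log(−s))S} V(e^{−(log(−s))S} (−s)^{−γ} y)`, `p̃(s, y) = (−s)^{2(γ−1)} P(e^{−(log(−s))S} (−s)^{−γ} y)` is a
distributional Euler pair on `(−∞,0) × ℝ³`.  (Below `b < 0` the `β`-rescaling about `(T, x₀)` with `β = (T−T₁)/(−b) + 1` lands in the spiral era and equals
the `R_β`-conjugate of `(ũ, p̃)`; un-conjugate with `R_β⁻¹`; exhaust `b ↑ 0`.) [folklore; ChaeTsai2013DSS p. 4] -/
theorem isDistributional_spiralCollapse_of_pastSpiral {γ T T₁ : ℝ} (hT₁ : T₁ ≤ 0) (hTT₁ : T₁ ≤ T)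
    (x₀ : EuclideanSpace ℝ (Fin 3)) (hS : ∀ x y : EuclideanSpace ℝ (Fin 3), ⟪S x, y⟫ = -⟪x, S y⟫)
    {u : ℝ → EuclideanSpace ℝ (Fin 3) → EuclideanSpace ℝ (Fin 3)} {p : ℝ → EuclideanSpace ℝ (Fin 3) → ℝ}
    (hsol : IsDistributionalNSSolutionOn (slab (EuclideanSpace ℝ (Fin 3)) (Iio 0) isOpen_Iio) 0 0 u p)
    {V : EuclideanSpace ℝ (Fin 3) → EuclideanSpace ℝ (Fin 3)} {P : EuclideanSpace ℝ (Fin 3) → ℝ}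
    (hu : ∀ τ : ℝ, τ < T₁ → u τ = fun x => (T - τ) ^ (γ - 1) •
      NormedSpace.exp ((Real.log (T - τ)) • S) (V (NormedSpace.exp ((-Real.log (T - τ)) • S) ((T - τ) ^ (-γ) • (x - x₀)))))
    (hp : ∀ τ : ℝ, τ < T₁ → p τ = fun x => (T - τ) ^ (2 * (γ - 1)) *
      P (NormedSpace.exp ((-Real.log (T - τ)) • S) ((T - τ) ^ (-γ) • (x - x₀)))) :
    IsDistributionalNSSolutionOn (slab (EuclideanSpace ℝ (Fin 3)) (Iio 0) isOpen_Iio) 0 0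
      (fun s y => (-s) ^ (γ - 1) •
        NormedSpace.exp ((Real.log (-s)) • S) (V (NormedSpace.exp ((-Real.log (-s)) • S) ((-s) ^ (-γ) • y))))
      (fun s y => (-s) ^ (2 * (γ - 1)) * P (NormedSpace.exp ((-Real.log (-s)) • S) ((-s) ^ (-γ) • y))) := by
  -- adapted from `Shifted.isDistributional_selfSimilarCollapse_of_past` (untwisted); delta = KEY ALGEBRA (ii)
  refine Shifted.isDistributional_slab_Iio_zero_of_forall fun b hb => ?_
  -- ### the similarity scaling that brings the spiral era below `b`
  have hb' : 0 < -b := neg_pos.2 hb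
  set β : ℝ := (T - T₁) / (-b) + 1 with hβdef
  have hβ : 0 < β := by
    have : 0 ≤ (T - T₁) / (-b) := div_nonneg (by linarith) hb'.le
    rw [hβdef]; linarith
  set lam : ℝ := β ^ γ with hlamdef
  set α : ℝ := β ^ (1 - γ) with hαdef
  have hlam : 0 < lam := Real.rpow_pos_of_pos hβ _
  have hα : 0 < α := Real.rpow_pos_of_pos hβ _
  have hαβ : β = α * lam := by
    rw [hαdef, hlamdef, ← Real.rpow_add hβ, show (1 - γ) + γ = 1 by ring, Real.rpow_one]
  -- the fixed rotation `R_β = e^{(log β)S}`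
  obtain ⟨R, hR, hRs⟩ := exists_rot hS (Real.log β)
  -- ### covariance
  have h1 := hsol.stRescale hα hlam hαβ T x₀
  have hf0 : ((α ^ 2 * lam) • stPull β lam T x₀ (0 : ℝ → EuclideanSpace ℝ (Fin 3) → EuclideanSpace ℝ (Fin 3))) = 0 := by
    funext s y
    simp [stPull]
  rw [mul_zero, zero_div, hf0] at h1
  -- ### restriction to the slab `(−∞, b)`, which the scaling maps into the spiral era `τ < T₁`
  have hβb : β * b = -(T - T₁) + b := by
    rw [hβdef, add_mul, one_mul, div_neg, neg_mul, div_mul_cancel₀ (T - T₁) hb.ne]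
  have htime : ∀ z : ℝ × EuclideanSpace ℝ (Fin 3),
      z ∈ (((slab (EuclideanSpace ℝ (Fin 3)) (Iio b) isOpen_Iio : Opens (ℝ × EuclideanSpace ℝ (Fin 3))) :
        Set (ℝ × EuclideanSpace ℝ (Fin 3)))) → T + β * z.1 < T₁ ∧ 0 < -z.1 := by
    intro z hz
    rw [SetLike.mem_coe, mem_slab, mem_Iio] at hz
    have : β * z.1 < β * b := mul_lt_mul_of_pos_left hz hβ
    exact ⟨by linarith, by linarith⟩
  have hle : slab (EuclideanSpace ℝ (Fin 3)) (Iio b) isOpen_Iio ≤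
      stPreimage β lam T x₀ (slab (EuclideanSpace ℝ (Fin 3)) (Iio 0) isOpen_Iio) := by
    intro z hz
    rw [mem_stPreimage, mem_slab, stAffine_fst, mem_Iio]
    have := (htime z hz).1
    linarith
  have h2 := h1.of_le hle
  -- ### on `(−∞, b)` the rescaled pair IS the `R_β`-CONJUGATE of the origin-centred spiral pair
  have hmeas : MeasurableSet (((slab (EuclideanSpace ℝ (Fin 3)) (Iio b) isOpen_Iio :
      Opens (ℝ × EuclideanSpace ℝ (Fin 3))) : Set (ℝ × EuclideanSpace ℝ (Fin 3)))) :=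
    (slab (EuclideanSpace ℝ (Fin 3)) (Iio b) isOpen_Iio).isOpen.measurableSet
  have h3 : IsDistributionalNSSolutionOn (slab (EuclideanSpace ℝ (Fin 3)) (Iio b) isOpen_Iio) 0 0
      (fun s y => R ((fun s y => (-s) ^ (γ - 1) •
        NormedSpace.exp ((Real.log (-s)) • S) (V (NormedSpace.exp ((-Real.log (-s)) • S) ((-s) ^ (-γ) • y)))) s (R.symm y)))
      (fun s y => (fun s y => (-s) ^ (2 * (γ - 1)) * P (NormedSpace.exp ((-Real.log (-s)) • S) ((-s) ^ (-γ) • y))) s (R.symm y)) := by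
    refine h2.congr_ae ((ae_restrict_iff' hmeas).2 (ae_of_all _ fun z hz => ?_))
      ((ae_restrict_iff' hmeas).2 (ae_of_all _ fun z hz => ?_))
    · obtain ⟨hτ, hs⟩ := htime z hz
      show (α • stPull β lam T x₀ u) z.1 z.2 = R ((-z.1) ^ (γ - 1) •
        NormedSpace.exp ((Real.log (-z.1)) • S) (V (NormedSpace.exp ((-Real.log (-z.1)) • S) ((-z.1) ^ (-γ) • R.symm z.2))))
      rw [smul_stPull_apply, hu _ hτ]
      simp only [add_sub_cancel_left, smul_smul]
      rw [show T - (T + β * z.1) = β * (-z.1) by ring, Shifted.rpow_one_sub_mul_mul_rpow hβ hs,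
        Shifted.mul_rpow_neg_mul_rpow hβ hs]
      obtain ⟨e1, e2⟩ := exp_log_mul_apply hβ hs hR hRs
        (V (NormedSpace.exp ((-Real.log (β * -z.1)) • S) ((-z.1) ^ (-γ) • z.2))) ((-z.1) ^ (-γ) • z.2)
      rw [e1, e2, map_smul, LinearIsometryEquiv.map_smul]
    · obtain ⟨hτ, hs⟩ := htime z hz
      show (α ^ 2 • stPull β lam T x₀ p) z.1 z.2 =
        (-z.1) ^ (2 * (γ - 1)) * P (NormedSpace.exp ((-Real.log (-z.1)) • S) ((-z.1) ^ (-γ) • R.symm z.2))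
      rw [smul_stPull_apply, hp _ hτ]
      simp only [add_sub_cancel_left, smul_smul, smul_eq_mul]
      rw [show T - (T + β * z.1) = β * (-z.1) by ring, ← mul_assoc, Shifted.rpow_one_sub_sq_mul_mul_rpow hβ hs,
        Shifted.mul_rpow_neg_mul_rpow hβ hs]
      obtain ⟨-, e2⟩ := exp_log_mul_apply hβ hs hR hRs 0 ((-z.1) ^ (-γ) • z.2)
      rw [e2, LinearIsometryEquiv.map_smul]
  -- ### un-conjugate with `R_β⁻¹`
  have h4 := PressureSlaving.isDistributional_conj_isometry isOpen_Iio h3 R.symm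
  have hf0' : (fun (s : ℝ) (x : EuclideanSpace ℝ (Fin 3)) =>
      R.symm ((0 : ℝ → EuclideanSpace ℝ (Fin 3) → EuclideanSpace ℝ (Fin 3)) s (R.symm.symm x))) = 0 := by
    funext s x
    simp
  rw [hf0'] at h4
  simp only [LinearIsometryEquiv.symm_symm, LinearIsometryEquiv.symm_apply_apply] at h4
  exact h4

end Spiral

end Summit.NavierStokesRegularity.NavierStokesRegularity.Theorems.PowerGaugeEulerLiouville

end
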